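import Mathlib.Probability.BorelCantelli
import Mathlib.Analysis.PSeries
import HarnessLib

/-!
# Transplant sharpness LV — the multi-scale (Borel–Cantelli) layer of the reinforced-ray programme

builds on p205010 (kernel theorem, internal audit signed; external expert review pending).
Status sentence (coordinator 2026-08-20T04:30Z): "θ(p_c) = 0 on ℤ^d, all d ≥ 2 — kernel-verified (Lean 4/Mathlib,
standard axioms); internal adversarial audit SIGNED 2026-08-20 04:29Z; external expert review pending."

Lane `prim-bschramm`, seat p5 (sharpness); memo `run/shared/lean/prim/bschramm/P5-SHARPNESS.md` §48 (row 85, kernel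
programme "RAY"; plan `run/shared/lean/prim/bschramm/prim-bschramm-p5-g22/RAY-PLAN.md` §5).

The programme blocks the origin of the reinforced square lattice by square annuli at the scales `N_j = 4^j N₀`
(pairwise edge-disjoint, hence independent), each blocked with probability only `≥ c / (A + j B)` — the logarithmic
loss of the second-moment matching step.  This file is the measure-theoretic endgame, free of percolation:

* `tsum_eq_top_of_ge_inv_affine` — if `μ(B j) ≥ c / (A + j B)` (`c, A, B > 0`) then `∑' j, μ (B j) = ∞`;
* `measure_limsup_eq_one_of_ge_inv_affine` — with independence, `B j` happens infinitely often almost surely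
  (Mathlib's second Borel–Cantelli lemma `ProbabilityTheory.measure_limsup_eq_one`);
* `measure_iUnion_eq_one_of_ge_inv_affine`, `measure_forall_not_mem_eq_zero` — in particular some `B j` happens
  almost surely, the form consumed by "a blocked annulus at some scale makes the cluster of the origin finite"
  (`Literature.Probability.Percolation.not_mem_percolatesAt_of_annulusBlocked`, Harris' theorem file).

References: K. L. Chung, P. Erdős, Trans. AMS 72 (1952); G. Grimmett, *Percolation* (1999), §11.7 (Harris' theorem via
blocked annuli); Y. Zhang, Ann. Probab. 22 (1994) 803–819.
-/

noncomputable section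

namespace Summit.CriticalPhenomena.PercolationContinuityZ3.Theorems.TransplantSharpness

namespace Ray

open MeasureTheory ProbabilityTheory Filter Finset
open scoped ENNReal Topology

variable {Ω : Type*} [MeasurableSpace Ω]

/-- Divergence of `Σ_{j<m} c/(A + j B)` for `c, A, B > 0` (comparison with the harmonic series). [folklore] -/
theorem tendsto_sum_div_affine_atTop {c A B : ℝ} (hc : 0 < c) (hA : 0 < A) (hB : 0 < B) :
    Tendsto (fun m : ℕ => ∑ j ∈ range m, c / (A + j * B)) atTop atTop := by
  have hcmp : ∀ m : ℕ, (c / (A + B)) * ∑ j ∈ range m, (1 : ℝ) / (j + 1) ≤ ∑ j ∈ range m, c / (A + j * B) := by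
    intro m
    rw [mul_sum]
    refine sum_le_sum fun j _ => ?_
    have hj : (0 : ℝ) ≤ j := by positivity
    have h1 : 0 < A + j * B := by positivity
    have h2 : (0 : ℝ) < j + 1 := by positivity
    have h3 : 0 < A + B := by positivity
    rw [div_mul_div_comm, mul_one, div_le_div_iff₀ (by positivity) h1]
    have : A + j * B ≤ (A + B) * (j + 1) := by nlinarith [mul_nonneg hj hA.le, mul_nonneg hj hB.le]
    calc c * (A + ↑j * B) ≤ c * ((A + B) * (j + 1)) := mul_le_mul_of_nonneg_left this hc.le
      _ = c * ((A + B) * (↑j + 1)) := by ring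
  have hharm : Tendsto (fun m : ℕ => ∑ j ∈ range m, (1 : ℝ) / (j + 1)) atTop atTop :=
    Real.tendsto_sum_range_one_div_nat_succ_atTop
  exact tendsto_atTop_mono hcmp (Tendsto.const_mul_atTop (by positivity) hharm)

/-- **The series of the blocking probabilities diverges**: if `μ(B j) ≥ c/(A + j B)` for all `j` with `c, A, B > 0`,
then `∑' j, μ (B j) = ∞`. [folklore] -/
theorem tsum_eq_top_of_ge_inv_affine (μ : Measure Ω) [IsFiniteMeasure μ] (B : ℕ → Set Ω) {c A Bc : ℝ}
    (hc : 0 < c) (hA : 0 < A) (hB : 0 < Bc) (hlow : ∀ j : ℕ, c / (A + j * Bc) ≤ μ.real (B j)) :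
    (∑' j, μ (B j)) = ∞ := by
  by_contra hne
  -- the real partial sums are bounded by the (finite) total
  have hbound : ∀ m : ℕ, ∑ j ∈ range m, c / (A + j * Bc) ≤ (∑' j, μ (B j)).toReal := by
    intro m
    calc ∑ j ∈ range m, c / (A + j * Bc) ≤ ∑ j ∈ range m, μ.real (B j) := sum_le_sum fun j _ => hlow j
      _ = (∑ j ∈ range m, μ (B j)).toReal := by
          rw [ENNReal.toReal_sum fun j _ => measure_ne_top μ (B j)]
          rfl
      _ ≤ (∑' j, μ (B j)).toReal :=
          ENNReal.toReal_mono hne (ENNReal.sum_le_tsum (range m))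
  have hdiv := tendsto_sum_div_affine_atTop hc hA hB
  rw [tendsto_atTop_atTop] at hdiv
  obtain ⟨m, hm⟩ := hdiv ((∑' j, μ (B j)).toReal + 1)
  have := (hm m le_rfl).trans (hbound m)
  linarith

/-- **Second Borel–Cantelli at logarithmic rate**: independent events with `μ(B j) ≥ c/(A + j B)` happen infinitely
often almost surely. [folklore] -/
theorem measure_limsup_eq_one_of_ge_inv_affine (μ : Measure Ω) [IsProbabilityMeasure μ] (B : ℕ → Set Ω)
    (hBm : ∀ j, MeasurableSet (B j)) (hind : iIndepSet B μ) {c A Bc : ℝ} (hc : 0 < c) (hA : 0 < A)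
    (hB : 0 < Bc) (hlow : ∀ j : ℕ, c / (A + j * Bc) ≤ μ.real (B j)) :
    μ (limsup B atTop) = 1 :=
  measure_limsup_eq_one hBm hind (tsum_eq_top_of_ge_inv_affine μ B hc hA hB hlow)

/-- **Some scale is blocked almost surely**: under the same hypotheses `μ(⋃ j, B j) = 1`. [folklore] -/
theorem measure_iUnion_eq_one_of_ge_inv_affine (μ : Measure Ω) [IsProbabilityMeasure μ] (B : ℕ → Set Ω)
    (hBm : ∀ j, MeasurableSet (B j)) (hind : iIndepSet B μ) {c A Bc : ℝ} (hc : 0 < c) (hA : 0 < A)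
    (hB : 0 < Bc) (hlow : ∀ j : ℕ, c / (A + j * Bc) ≤ μ.real (B j)) :
    μ (⋃ j, B j) = 1 := by
  have h1 := measure_limsup_eq_one_of_ge_inv_affine μ B hBm hind hc hA hB hlow
  have hsub : limsup B atTop ⊆ ⋃ j, B j := by
    intro ω hω
    rw [limsup_eq_iInf_iSup_of_nat] at hω
    simp only [Set.iSup_eq_iUnion, Set.iInf_eq_iInter, Set.mem_iInter, Set.mem_iUnion] at hω
    obtain ⟨j, -, hj⟩ := hω 0
    exact Set.mem_iUnion.2 ⟨j, hj⟩
  exact le_antisymm prob_le_one (h1 ▸ measure_mono hsub)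

/-- **Almost surely not all scales fail**: `μ {ω | ∀ j, ω ∉ B j} = 0`. [folklore] -/
theorem measure_forall_not_mem_eq_zero (μ : Measure Ω) [IsProbabilityMeasure μ] (B : ℕ → Set Ω)
    (hBm : ∀ j, MeasurableSet (B j)) (hind : iIndepSet B μ) {c A Bc : ℝ} (hc : 0 < c) (hA : 0 < A)
    (hB : 0 < Bc) (hlow : ∀ j : ℕ, c / (A + j * Bc) ≤ μ.real (B j)) :
    μ {ω | ∀ j, ω ∉ B j} = 0 := by
  have h1 := measure_iUnion_eq_one_of_ge_inv_affine μ B hBm hind hc hA hB hlow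
  have hc' : {ω | ∀ j, ω ∉ B j} = (⋃ j, B j)ᶜ := by
    ext ω; simp
  rw [hc', measure_compl (MeasurableSet.iUnion hBm) (measure_ne_top μ _), h1, measure_univ, tsub_self]

/-- **Transfer to a sub-event**: if every `B j` is contained in a set `F` (e.g. "the open cluster of the origin is
finite"), the hypotheses give `μ F = 1`, i.e. `μ Fᶜ = 0`. [folklore] -/
theorem measure_compl_eq_zero_of_subset (μ : Measure Ω) [IsProbabilityMeasure μ] (B : ℕ → Set Ω)
    (hBm : ∀ j, MeasurableSet (B j)) (hind : iIndepSet B μ) {c A Bc : ℝ} (hc : 0 < c) (hA : 0 < A)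
    (hB : 0 < Bc) (hlow : ∀ j : ℕ, c / (A + j * Bc) ≤ μ.real (B j)) {F : Set Ω} (hF : ∀ j, B j ⊆ F) :
    μ Fᶜ = 0 := by
  have h0 := measure_forall_not_mem_eq_zero μ B hBm hind hc hA hB hlow
  refine measure_mono_null (fun ω hω => ?_) h0
  simp only [Set.mem_setOf_eq]
  intro j hj
  exact hω (hF j hj)

end Ray

end Summit.CriticalPhenomena.PercolationContinuityZ3.Theorems.TransplantSharpness
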